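import Literature.NumberTheory.PAdicHodge.PerfectoidFiniteExtensionsCyclotomic
import Literature.NumberTheory.PAdicHodge.TateAlmostEtaleSylow
import Literature.NumberTheory.PAdicHodge.TateAlmostEtaleDescent
import Literature.NumberTheory.PAdicHodge.TateAlmostEtaleTamePackage

/-!
# Finite extensions of `ℚ_p(μ_{p^∞})` inside `F̄`: Frobenius surjectivity on `T°/p` from the tame package

Sequel to `PerfectoidFiniteExtensionsCyclotomic` (the cite-only fact
`scholze2012_frobeniusSurjective_finite_over_Kinf`: for every finite `T ⊇ K_∞ = ℚ_p(ζ_{p^∞})` inside `F̄`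
and every integer `u ∈ T` there is `w ∈ T` with `‖u − w^p‖ ≤ ‖p‖` — Scholze 2012 Thm. 3.7 (i) for the base
`ℚ_p(μ_{p^∞})^`, Kedlaya–Liu Thm. 4.5.6). Here that statement is DERIVED from the tame package (C) of
`TateSenConditionKummerRoute` (the almost-perfectoid package of the finite extensions of `K_∞` of degree
prime to `p`), by three tool theorems:

* `frobeniusSurjective_of_package` — **bootstrap `(Γ) ∧ (U_s) ⇒ (U_1)`**: if the value group of `T` is
  `p`-divisible and every integer is a `p`-th power modulo `‖p‖^s` for some `s > 0`, then every integer
  is a `p`-th power modulo `p` (write `u − w^p = c^p r″` with `‖r″‖ = 1`, `r″ = w′^p + O(‖p‖^s)`, and take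
  `W = w + c w′`: the binomial cross terms are `O(p)`, so `‖u − W^p‖ ≤ max (‖p‖, ‖p‖^{2s})`; iterate
  `s ↦ min 1 (2s)`);
* `package_lift_of_tame_galois` / `package_of_tame` — **the package of EVERY finite `T ⊇ K_∞`** granted
  (C): with `N` the Galois closure of `T` over `K_∞` in `F̄`, `H = Gal(N/T)`, Sylow subgroups `P_H ≤ P`,
  the package of `N^P` (prime to `p` over `K_∞`, hypothesis (C)) ascends along the `p`-chain to `N^{P_H}`
  (`pChain_package`) and DESCENDS to `T` (`package_descent`, `[N^{P_H} : T] = [H : P_H]` prime to `p`)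
  — the same Sylow bookkeeping as `prop9_galois_of_tame`;
* `frobeniusSurjective_of_tame` — (C) for every `p`-adic field `⇒ scholze2012_frobeniusSurjective_finite_over_Kinf`;
* `scholze2012_frobeniusSurjective_finite_over_Kinf_holds` — **the discharge**: (C) is the theorem
  `TateAlmostEtale.tamePackage` (`TateAlmostEtaleTamePackage`, the norm-only tame structure theorem over
  `ℚ_p(ζ_{p^∞})`), so the named fact holds UNCONDITIONALLY for every `p`-adic field `F` and every prime `p`.

So the cite-only input of `tate1967_TS1_of_scholze2012` is a tree theorem (as is (TS1) itself,
`tate1967_TS1_completedAlgClosure_holds`). Theorems only (no definition, no `sorry`); nothing about BSD is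
proved here.
[cite: Scholze2012, Lemma 3.2 and Thm. 3.7 (i)] [cite: Tate1967, §3.2 Prop. 9] [cite: BergerColmez2008, Prop. 4.1.1]
-/

noncomputable section

open Polynomial IntermediateField Module ValuativeRel Field

namespace Literature.NumberTheory.PAdicHodge

namespace TateAlmostEtale

open Literature.NumberTheory.GaloisRepresentations
open Literature.NumberTheory.GaloisRepresentations.IsNonarchimedeanLocalField

variable {F : Type} [Field F] [ValuativeRel F] [TopologicalSpace F] [IsNonarchimedeanLocalField F]
  [CharZero F] {p : ℕ} [Fact p.Prime] (hp : valuation F p < 1)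

/-! ### §1 Bootstrap: `(Γ) ∧ (U_s) ⇒ (U_1)` -/

omit [CharZero F] in
/-- `‖x - y‖ ≤ max ‖x‖ ‖y‖` in the ultrametric field `F̄`. Auxiliary. [folklore] -/
private theorem norm_sub_le_max' (x y : NormedAlgClosure F) : ‖x - y‖ ≤ max ‖x‖ ‖y‖ := by
  rw [sub_eq_add_neg, ← norm_neg y]; exact IsUltrametricDist.norm_add_le_max x (-y)

include hp in
/-- **One bootstrap step `(U_s) ⇒ (U_{min 1 (2s)})` under (Γ).** For a subfield `T ⊆ F̄` whose value group
is `p`-divisible ((Γ)) and in which every integer is a `p`-th power modulo `‖p‖^s`: every integer is a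
`p`-th power modulo `‖p‖^{min 1 (2s)}`. With `u − w^p = r = c^p r″`, `‖c‖^p = ‖r‖`, `‖r″‖ = 1`,
`r″ = w′^p + O(‖p‖^s)` and `W = w + c w′`:
`u − W^p = c^p (r″ − w′^p) − ((w + cw′)^p − w^p − (cw′)^p)`, the first term is `O(‖p‖^{2s})` and the
second `O(‖p‖)` (`norm_add_pow_sub_le`). [cite: Scholze2012, Lemma 3.2 (proof)] -/
theorem frobeniusSurjective_step {K : Type*} [Field K] [Algebra K (NormedAlgClosure F)]
    (T : IntermediateField K (NormedAlgClosure F))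
    (hΓ : ∀ x ∈ T, x ≠ 0 → ∃ c ∈ T, ‖c‖ ^ p = ‖x‖) {s : ℝ} (hs : 0 < s)
    (hU : ∀ u ∈ T, ‖u‖ ≤ 1 → ∃ w ∈ T, ‖u - w ^ p‖ ≤ ‖(p : NormedAlgClosure F)‖ ^ s)
    {u : NormedAlgClosure F} (hu : u ∈ T) (hu1 : ‖u‖ ≤ 1) :
    ∃ w ∈ T, ‖u - w ^ p‖ ≤ ‖(p : NormedAlgClosure F)‖ ^ (min 1 (2 * s)) := by
  have hprime : p.Prime := Fact.out
  have hp0 : (p : NormedAlgClosure F) ≠ 0 := Nat.cast_ne_zero.mpr hprime.ne_zero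
  have hq0 : 0 < ‖(p : NormedAlgClosure F)‖ := norm_pos_iff.mpr hp0
  have hq1 : ‖(p : NormedAlgClosure F)‖ < 1 := by
    rw [PadicBase.norm_natCast_closure hp]; exact PadicBase.norm_p_lt_one hp
  have hqs1 : ‖(p : NormedAlgClosure F)‖ ^ s ≤ 1 := Real.rpow_le_one hq0.le hq1.le hs.le
  -- the target exponent dominates both `1` and `2s`
  have hmin1 : ‖(p : NormedAlgClosure F)‖ ≤ ‖(p : NormedAlgClosure F)‖ ^ (min 1 (2 * s)) := by
    conv_lhs => rw [← Real.rpow_one ‖(p : NormedAlgClosure F)‖]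
    exact Real.rpow_le_rpow_of_exponent_ge hq0 hq1.le (min_le_left _ _)
  have hmin2 : ‖(p : NormedAlgClosure F)‖ ^ (2 * s) ≤ ‖(p : NormedAlgClosure F)‖ ^ (min 1 (2 * s)) :=
    Real.rpow_le_rpow_of_exponent_ge hq0 hq1.le (min_le_right _ _)
  -- first approximation
  obtain ⟨w, hwT, hw⟩ := hU u hu hu1
  set r : NormedAlgClosure F := u - w ^ p with hr
  have hrT : r ∈ T := sub_mem hu (pow_mem hwT p)
  have hr1 : ‖r‖ ≤ 1 := hw.trans hqs1
  have hw1 : ‖w‖ ≤ 1 := by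
    have h : ‖w ^ p‖ ≤ 1 := by
      have : w ^ p = u - r := by rw [hr]; ring
      rw [this]
      exact (norm_sub_le_max' u r).trans (max_le hu1 hr1)
    rw [norm_pow] at h
    exact (pow_le_one_iff_of_nonneg (norm_nonneg _) hprime.ne_zero).mp h
  by_cases hr0 : r = 0
  · refine ⟨w, hwT, ?_⟩
    rw [← hr, hr0, norm_zero]
    exact Real.rpow_nonneg hq0.le _
  -- rescale the error to a unit: `r = c^p r″`
  obtain ⟨c, hcT, hc⟩ := hΓ r hrT hr0
  have hrpos : 0 < ‖r‖ := norm_pos_iff.mpr hr0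
  have hc0 : c ≠ 0 := by
    intro h
    rw [h, norm_zero, zero_pow hprime.ne_zero] at hc
    exact hrpos.ne hc
  have hcp0 : c ^ p ≠ 0 := pow_ne_zero p hc0
  have hc1 : ‖c‖ ≤ 1 := by
    have h : ‖c‖ ^ p ≤ 1 := hc ▸ hr1
    exact (pow_le_one_iff_of_nonneg (norm_nonneg _) hprime.ne_zero).mp h
  set r'' : NormedAlgClosure F := r / c ^ p with hr''
  have hr''T : r'' ∈ T := div_mem hrT (pow_mem hcT p)
  have hr''n : ‖r''‖ = 1 := by
    rw [hr'', norm_div, norm_pow, hc, div_self hrpos.ne']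
  obtain ⟨w', hw'T, hw'⟩ := hU r'' hr''T hr''n.le
  have hw'1 : ‖w'‖ ≤ 1 := by
    have h : ‖w' ^ p‖ ≤ 1 := by
      have : w' ^ p = r'' - (r'' - w' ^ p) := by ring
      rw [this]
      exact (norm_sub_le_max' _ _).trans (max_le hr''n.le (hw'.trans hqs1))
    rw [norm_pow] at h
    exact (pow_le_one_iff_of_nonneg (norm_nonneg _) hprime.ne_zero).mp h
  -- the corrected root `W = w + c w'`
  refine ⟨w + c * w', add_mem hwT (mul_mem hcT hw'T), ?_⟩
  have key : u - (w + c * w') ^ p =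
      c ^ p * (r'' - w' ^ p) - ((w + c * w') ^ p - w ^ p - (c * w') ^ p) := by
    have h1 : c ^ p * r'' = r := by rw [hr'']; field_simp
    rw [mul_sub, h1, hr, mul_pow]; ring
  rw [key]
  refine (norm_sub_le_max' _ _).trans (max_le ?_ ?_)
  · -- `‖c^p (r″ - w′^p)‖ ≤ ‖p‖^s · ‖p‖^s`
    rw [norm_mul, norm_pow, hc]
    calc ‖r‖ * ‖r'' - w' ^ p‖
        ≤ ‖(p : NormedAlgClosure F)‖ ^ s * ‖(p : NormedAlgClosure F)‖ ^ s :=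
          mul_le_mul hw hw' (norm_nonneg _) (Real.rpow_nonneg hq0.le s)
      _ = ‖(p : NormedAlgClosure F)‖ ^ (2 * s) := by
          rw [← Real.rpow_add hq0]; ring_nf
      _ ≤ _ := hmin2
  · -- binomial cross terms are divisible by `p`
    have hcw : ‖c * w'‖ ≤ 1 := by
      rw [norm_mul]; exact mul_le_one₀ hc1 (norm_nonneg _) hw'1
    exact (norm_add_pow_sub_le hprime w (c * w') hw1 hcw).trans hmin1

/-- `min 1 (2 · min 1 a) = min 1 (2 a)` for `0 < a`. Auxiliary. [folklore] -/
private theorem min_one_two_mul_min (a : ℝ) (ha : 0 < a) : min 1 (2 * min 1 a) = min 1 (2 * a) := by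
  rcases le_or_gt 1 a with h | h
  · rw [min_eq_left h, mul_one, min_eq_left (by norm_num : (1 : ℝ) ≤ 2),
      min_eq_left (by linarith : (1 : ℝ) ≤ 2 * a)]
  · rw [min_eq_right h.le]

include hp in
/-- **Bootstrap `(Γ) ∧ (U_s) ⇒ (U_1)`: Frobenius is surjective on `T°/p`.** For a subfield `T ⊆ F̄` with
`p`-divisible value group in which every integer is a `p`-th power modulo `‖p‖^s` for some `s > 0`, every
integer `u ∈ T` has a `w ∈ T` with `‖u − w^p‖ ≤ ‖p‖` (iterate `frobeniusSurjective_step` until `2^k s ≥ 1`).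
[cite: Scholze2012, Def. 3.1 and Lemma 3.2] -/
theorem frobeniusSurjective_of_package {K : Type*} [Field K] [Algebra K (NormedAlgClosure F)]
    (T : IntermediateField K (NormedAlgClosure F))
    (hΓ : ∀ x ∈ T, x ≠ 0 → ∃ c ∈ T, ‖c‖ ^ p = ‖x‖) {s : ℝ} (hs : 0 < s)
    (hU : ∀ u ∈ T, ‖u‖ ≤ 1 → ∃ w ∈ T, ‖u - w ^ p‖ ≤ ‖(p : NormedAlgClosure F)‖ ^ s)
    {u : NormedAlgClosure F} (hu : u ∈ T) (hu1 : ‖u‖ ≤ 1) :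
    ∃ w ∈ T, ‖u - w ^ p‖ ≤ ‖(p : NormedAlgClosure F)‖ := by
  -- `(U_{min 1 (2^k s)})` for every `k`
  have hiter : ∀ k : ℕ, ∀ v ∈ T, ‖v‖ ≤ 1 →
      ∃ w ∈ T, ‖v - w ^ p‖ ≤ ‖(p : NormedAlgClosure F)‖ ^ (min 1 (2 ^ k * s)) := by
    intro k
    induction k with
    | zero =>
      intro v hv hv1
      rw [pow_zero, one_mul]
      -- `(U_s) ⇒ (U_{min 1 s})`
      obtain ⟨w, hw, h⟩ := hU v hv hv1
      refine ⟨w, hw, h.trans ?_⟩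
      have hprime : p.Prime := Fact.out
      have hq0 : 0 < ‖(p : NormedAlgClosure F)‖ :=
        norm_pos_iff.mpr (Nat.cast_ne_zero.mpr hprime.ne_zero)
      have hq1 : ‖(p : NormedAlgClosure F)‖ < 1 := by
        rw [PadicBase.norm_natCast_closure hp]; exact PadicBase.norm_p_lt_one hp
      exact Real.rpow_le_rpow_of_exponent_ge hq0 hq1.le (min_le_right _ _)
    | succ k ih =>
      intro v hv hv1
      have hpos : 0 < min 1 (2 ^ k * s) := lt_min one_pos (by positivity)
      obtain ⟨w, hw, h⟩ := frobeniusSurjective_step hp T hΓ hpos ih hv hv1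
      refine ⟨w, hw, ?_⟩
      rwa [min_one_two_mul_min _ (by positivity), ← mul_assoc, ← pow_succ'] at h
  -- choose `k` with `2^k s ≥ 1`
  obtain ⟨k, hk⟩ : ∃ k : ℕ, 1 ≤ 2 ^ k * s := by
    obtain ⟨n, hn⟩ := exists_nat_gt (1 / s)
    refine ⟨n, ?_⟩
    have h2 : (n : ℝ) ≤ 2 ^ n := by exact_mod_cast Nat.lt_two_pow_self.le
    have : 1 / s ≤ 2 ^ n := hn.le.trans h2
    rwa [div_le_iff₀ hs] at this
  obtain ⟨w, hw, h⟩ := hiter k u hu hu1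
  refine ⟨w, hw, ?_⟩
  rwa [min_eq_left hk, Real.rpow_one] at h

/-! ### §2 The package of every finite `T ⊇ K_∞` from the tame package (C) -/

set_option synthInstance.maxHeartbeats 200000 in
set_option maxHeartbeats 1600000 in
/-- **The package of `L₂` for `K_∞ ⊆ L₂ ⊆ L ⊆ F̄`, `L/K_∞` finite Galois, granted the tame package (C).**
With `G = Gal(L/K_∞)`, `H = Gal(L/L₂)`, Sylow subgroups `P_H ≤ P`: `L^P` is prime to `p` over `K_∞`, so
it has the package by (C); the package ascends along the `p`-chain `P_H ≤ P` to `L^{P_H}`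
(`pChain_package`); and it descends from `L^{P_H}` to `L₂` because `[L^{P_H} : L₂] = [H : P_H]` is prime to
`p` (`package_descent`). Stated for the lift of `L₂` to `F̄`. [cite: Tate1967, §3.2 Prop. 9] [cite: Scholze2012, Lemma 3.2 and Thm. 3.7 (i)] -/
theorem package_lift_of_tame_galois
    (hC : ∀ (T : IntermediateField (TateTrace.Kinf hp) (NormedAlgClosure F)),
      FiniteDimensional (TateTrace.Kinf hp) T → ¬ p ∣ finrank (TateTrace.Kinf hp) T →
      ∃ s : ℝ, 0 < s ∧ (∀ x ∈ T, x ≠ 0 → ∃ c ∈ T, ‖c‖ ^ p = ‖x‖) ∧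
        (∀ u ∈ T, ‖u‖ ≤ 1 → ∃ w ∈ T, ‖u - w ^ p‖ ≤ ‖(p : NormedAlgClosure F)‖ ^ s))
    (L : IntermediateField (TateTrace.Kinf hp) (NormedAlgClosure F))
    [FiniteDimensional (TateTrace.Kinf hp) L] [IsGalois (TateTrace.Kinf hp) L]
    (L₂ : IntermediateField (TateTrace.Kinf hp) L) :
    ∃ s : ℝ, 0 < s ∧
      (∀ x ∈ IntermediateField.lift L₂, x ≠ 0 → ∃ c ∈ IntermediateField.lift L₂, ‖c‖ ^ p = ‖x‖) ∧
      (∀ u ∈ IntermediateField.lift L₂, ‖u‖ ≤ 1 →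
        ∃ w ∈ IntermediateField.lift L₂, ‖u - w ^ p‖ ≤ ‖(p : NormedAlgClosure F)‖ ^ s) := by
  classical
  have hprime : p.Prime := Fact.out
  -- the groups `H = Gal(L/L₂) ≤ G = Gal(L/K_∞)`, Sylow subgroups `P_H ≤ P`
  set H : Subgroup (L ≃ₐ[TateTrace.Kinf hp] L) := L₂.fixingSubgroup with hH
  have hL₂ : IntermediateField.fixedField H = L₂ := IsGalois.fixedField_fixingSubgroup L₂
  obtain ⟨PH⟩ : Nonempty (Sylow p H) := Sylow.nonempty
  set PH' : Subgroup (L ≃ₐ[TateTrace.Kinf hp] L) := (PH : Subgroup H).map H.subtype with hPH'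
  have hPH'p : IsPGroup p PH' := PH.isPGroup'.map H.subtype
  obtain ⟨P, hP⟩ := hPH'p.exists_le_sylow
  have hPH'H : PH' ≤ H := by rw [hPH']; exact Subgroup.map_subtype_le _
  have hcardPH' : Nat.card PH' = Nat.card PH := by
    rw [hPH']; exact Subgroup.card_map_of_injective H.subtype_injective
  -- degrees
  have hG : Nat.card (L ≃ₐ[TateTrace.Kinf hp] L) = finrank (TateTrace.Kinf hp) L :=
    IsGalois.card_aut_eq_finrank _ _
  have hHL : finrank L₂ L = Nat.card H := by
    rw [← hL₂]; exact IntermediateField.finrank_fixedField_eq_card H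
  set X : IntermediateField (TateTrace.Kinf hp) L := IntermediateField.fixedField PH' with hX
  have hle : L₂ ≤ X := by
    intro x hx
    rw [hX, IntermediateField.mem_fixedField_iff]
    intro g hg
    have hx' : x ∈ IntermediateField.fixedField H := by rw [hL₂]; exact hx
    rw [IntermediateField.mem_fixedField_iff] at hx'
    exact hx' g (hPH'H hg)
  have hXL : finrank X L = Nat.card PH' := by
    rw [hX]; exact IntermediateField.finrank_fixedField_eq_card PH'
  set XP : IntermediateField (TateTrace.Kinf hp) L :=
    IntermediateField.fixedField (P : Subgroup (L ≃ₐ[TateTrace.Kinf hp] L)) with hXP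
  have hXPL : finrank XP L = Nat.card P := by
    rw [hXP]; exact IntermediateField.finrank_fixedField_eq_card _
  -- (C) for `T = L^P`, of degree `[G : P]` prime to `p`
  set T : IntermediateField (TateTrace.Kinf hp) (NormedAlgClosure F) := IntermediateField.lift XP
    with hT
  haveI hTfin : FiniteDimensional (TateTrace.Kinf hp) T :=
    LinearEquiv.finiteDimensional (IntermediateField.liftAlgEquiv XP).toLinearEquiv
  have hTrk : finrank (TateTrace.Kinf hp) T =
      (P : Subgroup (L ≃ₐ[TateTrace.Kinf hp] L)).index := by
    have h1 : finrank (TateTrace.Kinf hp) T = finrank (TateTrace.Kinf hp) XP :=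
      (IntermediateField.liftAlgEquiv XP).toLinearEquiv.finrank_eq.symm
    have h2 := Module.finrank_mul_finrank (TateTrace.Kinf hp) XP L
    rw [hXPL, ← hG, ← (P : Subgroup (L ≃ₐ[TateTrace.Kinf hp] L)).index_mul_card] at h2
    rw [h1]
    exact Nat.eq_of_mul_eq_mul_right Nat.card_pos h2
  have hnd : ¬ p ∣ finrank (TateTrace.Kinf hp) T := by
    rw [hTrk]; exact P.not_dvd_index
  obtain ⟨s, hs, hΓT, hUT⟩ := hC T hTfin hnd
  -- (D′1): the package of `L^{P_H}`
  obtain ⟨s₁, hs₁, hΓ₁, hU₁⟩ := pChain_package hp (TateTrace.Kinf hp) le_rfl L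
    (P : Subgroup (L ≃ₐ[TateTrace.Kinf hp] L)) PH' hP P.isPGroup' hs hΓT hUT
  -- degrees: `d = [X : L₂] = [H : P_H]` is prime to `p`
  set X' : IntermediateField L₂ L := IntermediateField.extendScalars hle with hX'
  set d : ℕ := finrank L₂ X' with hd
  have hd1 : finrank (TateTrace.Kinf hp) L₂ * d = finrank (TateTrace.Kinf hp) X := by
    rw [hd, hX', ← IntermediateField.relfinrank_eq_finrank_of_le hle]
    exact IntermediateField.finrank_bot_mul_relfinrank hle
  have hd2 : finrank (TateTrace.Kinf hp) X * Nat.card PH' = Nat.card (L ≃ₐ[TateTrace.Kinf hp] L) := by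
    rw [hG, ← hXL]; exact Module.finrank_mul_finrank _ X L
  have hd3 : finrank (TateTrace.Kinf hp) L₂ * Nat.card H = Nat.card (L ≃ₐ[TateTrace.Kinf hp] L) := by
    rw [hG, ← hHL]; exact Module.finrank_mul_finrank _ L₂ L
  have hd4 : (PH : Subgroup H).index * Nat.card PH = Nat.card H := (PH : Subgroup H).index_mul_card
  have hdeq : d = (PH : Subgroup H).index := by
    have ha : 0 < finrank (TateTrace.Kinf hp) L₂ := Module.finrank_pos
    have hcP : 0 < Nat.card PH := Nat.card_pos
    have h13 : finrank (TateTrace.Kinf hp) L₂ * Nat.card H =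
        finrank (TateTrace.Kinf hp) X * Nat.card PH := by rw [← hcardPH', hd2]; exact hd3
    rw [← hd1, ← hd4, mul_assoc] at h13
    exact (Nat.eq_of_mul_eq_mul_right hcP (Nat.eq_of_mul_eq_mul_left ha h13)).symm
  have hdp : ¬ p ∣ d := by rw [hdeq]; exact PH.not_dvd_index
  -- the `E`-world: base `M = lift L₂` over `K₀`, top `Lx = lift X` over `M`
  set M : IntermediateField (PadicBase F p hp) (NormedAlgClosure F) :=
    (IntermediateField.lift L₂).restrictScalars (PadicBase F p hp) with hM
  have hmemM : ∀ x : NormedAlgClosure F, x ∈ M ↔ x ∈ IntermediateField.lift L₂ := fun x =>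
    IntermediateField.mem_restrictScalars (PadicBase F p hp)
  have hMX : M ≤ (IntermediateField.lift X).restrictScalars (PadicBase F p hp) := by
    intro x hx
    rw [IntermediateField.mem_restrictScalars]
    have hx' : x ∈ IntermediateField.lift L₂ := (hmemM x).mp hx
    have hxL : x ∈ L := IntermediateField.lift_le L₂ hx'
    have hx₂ : (⟨x, hxL⟩ : L) ∈ L₂ := (IntermediateField.mem_lift (⟨x, hxL⟩ : L)).mp hx'
    exact (IntermediateField.mem_lift (⟨x, hxL⟩ : L)).mpr (hle hx₂)
  set Lx : IntermediateField M (NormedAlgClosure F) := IntermediateField.extendScalars hMX with hLx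
  have hmemLx : ∀ x : NormedAlgClosure F, x ∈ Lx ↔ x ∈ IntermediateField.lift X := fun x => Iff.rfl
  -- transport `X'/L₂ ≅ Lx/M` (identity on `F̄`)
  let f : L₂ ≃+* M :=
    { toFun := fun x => ⟨((x : L) : NormedAlgClosure F),
        (hmemM _).mpr ((IntermediateField.mem_lift (x : L)).mpr x.2)⟩
      invFun := fun m => ⟨⟨(m : NormedAlgClosure F),
          IntermediateField.lift_le L₂ ((hmemM _).mp m.2)⟩,
          (IntermediateField.mem_lift (⟨(m : NormedAlgClosure F),
            IntermediateField.lift_le L₂ ((hmemM _).mp m.2)⟩ : L)).mp ((hmemM _).mp m.2)⟩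
      left_inv := fun x => rfl
      right_inv := fun m => rfl
      map_mul' := fun x y => rfl
      map_add' := fun x y => rfl }
  let g : X' ≃+* Lx :=
    { toFun := fun x => ⟨((x : L) : NormedAlgClosure F),
        (hmemLx _).mpr ((IntermediateField.mem_lift (x : L)).mpr x.2)⟩
      invFun := fun m => ⟨⟨(m : NormedAlgClosure F),
          IntermediateField.lift_le X ((hmemLx _).mp m.2)⟩,
          (IntermediateField.mem_lift (⟨(m : NormedAlgClosure F),
            IntermediateField.lift_le X ((hmemLx _).mp m.2)⟩ : L)).mp ((hmemLx _).mp m.2)⟩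
      left_inv := fun x => rfl
      right_inv := fun m => rfl
      map_mul' := fun x y => rfl
      map_add' := fun x y => rfl }
  have hcomp : (algebraMap M Lx).comp f.toRingHom = g.toRingHom.comp (algebraMap L₂ X') := by
    ext x; rfl
  haveI : FiniteDimensional M Lx := Module.Finite.of_equiv_equiv f g hcomp
  have hfinLx : finrank M Lx = d := by
    rw [hd]; exact (Algebra.finrank_eq_of_equiv_equiv f g hcomp).symm
  have hndLx : ¬ p ∣ finrank M Lx := by rw [hfinLx]; exact hdp
  -- the package of `Lx = lift X` from (D′1), and descent to `M = lift L₂`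
  have hΓLx : ∀ x ∈ Lx, x ≠ 0 → ∃ c ∈ Lx, ‖c‖ ^ p = ‖x‖ := by
    intro x hx hx0
    obtain ⟨c, hc, h⟩ := hΓ₁ x ((hmemLx x).mp hx) hx0
    exact ⟨c, (hmemLx c).mpr hc, h⟩
  have hULx : ∀ u ∈ Lx, ‖u‖ ≤ 1 → ∃ w ∈ Lx, ‖u - w ^ p‖ ≤ ‖(p : NormedAlgClosure F)‖ ^ s₁ := by
    intro u hu hu1
    obtain ⟨w, hw, h⟩ := hU₁ u ((hmemLx u).mp hu) hu1
    exact ⟨w, (hmemLx w).mpr hw, h⟩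
  obtain ⟨hΓM, hUM⟩ := package_descent hp M Lx hndLx hs₁ hΓLx hULx
  refine ⟨min s₁ 1, lt_min hs₁ one_pos, fun x hx hx0 => ?_, fun u hu hu1 => ?_⟩
  · obtain ⟨c, hc, h⟩ := hΓM x ((hmemM x).mpr hx) hx0
    exact ⟨c, (hmemM c).mp hc, h⟩
  · obtain ⟨w, hw, h⟩ := hUM u ((hmemM u).mpr hu) hu1
    exact ⟨w, (hmemM w).mp hw, h⟩

set_option synthInstance.maxHeartbeats 200000 in
set_option maxHeartbeats 800000 in
/-- **The almost-perfectoid package of EVERY finite extension `T ⊇ K_∞` inside `F̄`, granted the tame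
package (C)** (pass to the Galois closure of `T` over `K_∞` in `F̄`, Mathlib `normalClosure`, and apply
`package_lift_of_tame_galois`). [cite: Tate1967, §3.2 Prop. 9] [cite: Scholze2012, Thm. 3.7 (i)] -/
theorem package_of_tame
    (hC : ∀ (T : IntermediateField (TateTrace.Kinf hp) (NormedAlgClosure F)),
      FiniteDimensional (TateTrace.Kinf hp) T → ¬ p ∣ finrank (TateTrace.Kinf hp) T →
      ∃ s : ℝ, 0 < s ∧ (∀ x ∈ T, x ≠ 0 → ∃ c ∈ T, ‖c‖ ^ p = ‖x‖) ∧
        (∀ u ∈ T, ‖u‖ ≤ 1 → ∃ w ∈ T, ‖u - w ^ p‖ ≤ ‖(p : NormedAlgClosure F)‖ ^ s))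
    (T : IntermediateField (TateTrace.Kinf hp) (NormedAlgClosure F))
    (hfin : FiniteDimensional (TateTrace.Kinf hp) T) :
    ∃ s : ℝ, 0 < s ∧ (∀ x ∈ T, x ≠ 0 → ∃ c ∈ T, ‖c‖ ^ p = ‖x‖) ∧
      (∀ u ∈ T, ‖u‖ ≤ 1 → ∃ w ∈ T, ‖u - w ^ p‖ ≤ ‖(p : NormedAlgClosure F)‖ ^ s) := by
  classical
  haveI := hfin
  -- the Galois closure `N` of `T` over `K_∞` inside `F̄`
  haveI : Normal (TateTrace.Kinf hp) (NormedAlgClosure F) :=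
    Normal.tower_top_of_normal (PadicBase F p hp) (TateTrace.Kinf hp) (NormedAlgClosure F)
  set N : IntermediateField (TateTrace.Kinf hp) (NormedAlgClosure F) :=
    normalClosure (TateTrace.Kinf hp) T (NormedAlgClosure F) with hN
  haveI : CharZero (TateTrace.Kinf hp) :=
    charZero_of_injective_algebraMap (algebraMap (PadicBase F p hp) (TateTrace.Kinf hp)).injective
  haveI : Algebra.IsSeparable (TateTrace.Kinf hp) N := Algebra.IsAlgebraic.isSeparable_of_perfectField
  haveI : IsGalois (TateTrace.Kinf hp) N := isGalois_iff.mpr ⟨inferInstance, inferInstance⟩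
  have hTN : T ≤ N := IntermediateField.le_normalClosure T
  set TN : IntermediateField (TateTrace.Kinf hp) N := IntermediateField.restrict hTN with hTN'
  have hlift : IntermediateField.lift TN = T := IntermediateField.lift_restrict hTN
  obtain ⟨s, hs, hΓ, hU⟩ := package_lift_of_tame_galois hp hC N TN
  rw [hlift] at hΓ hU
  exact ⟨s, hs, hΓ, hU⟩

/-! ### §3 Frobenius surjectivity from the tame package -/

/-- **Frobenius surjectivity on `T°/p` for every finite `T ⊇ K_∞` inside `F̄`, granted the tame package
(C) for the `p`-adic field `F`** (`package_of_tame` + the bootstrap `frobeniusSurjective_of_package`).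
[cite: Scholze2012, Def. 3.1, Lemma 3.2 and Thm. 3.7 (i)] -/
theorem frobeniusSurjective_of_tame_local
    (hC : ∀ (T : IntermediateField (TateTrace.Kinf hp) (NormedAlgClosure F)),
      FiniteDimensional (TateTrace.Kinf hp) T → ¬ p ∣ finrank (TateTrace.Kinf hp) T →
      ∃ s : ℝ, 0 < s ∧ (∀ x ∈ T, x ≠ 0 → ∃ c ∈ T, ‖c‖ ^ p = ‖x‖) ∧
        (∀ u ∈ T, ‖u‖ ≤ 1 → ∃ w ∈ T, ‖u - w ^ p‖ ≤ ‖(p : NormedAlgClosure F)‖ ^ s))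
    (T : IntermediateField (TateTrace.Kinf hp) (NormedAlgClosure F))
    (hfin : FiniteDimensional (TateTrace.Kinf hp) T)
    {u : NormedAlgClosure F} (hu : u ∈ T) (hu1 : ‖u‖ ≤ 1) :
    ∃ w ∈ T, ‖u - w ^ p‖ ≤ ‖(p : NormedAlgClosure F)‖ := by
  obtain ⟨s, hs, hΓ, hU⟩ := package_of_tame hp hC T hfin
  exact frobeniusSurjective_of_package hp T hΓ hs hU hu hu1

/-- **`scholze2012_frobeniusSurjective_finite_over_Kinf` from the tame package (C) for every `p`-adic
field** — the cite-only input of `tate1967_TS1_of_scholze2012` is a consequence of the hypothesis of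
`tate1967_TS1_of_tame`. [cite: Scholze2012, Thm. 3.7 (i)] [cite: Tate1967, §3.2 Prop. 9] -/
theorem frobeniusSurjective_of_tame
    (hC : ∀ {F : Type} [Field F] [ValuativeRel F] [TopologicalSpace F] [IsNonarchimedeanLocalField F]
      [CharZero F] {p : ℕ} [Fact p.Prime] (hp : valuation F p < 1)
      (T : IntermediateField (TateTrace.Kinf hp) (NormedAlgClosure F)),
      FiniteDimensional (TateTrace.Kinf hp) T → ¬ p ∣ finrank (TateTrace.Kinf hp) T →
      ∃ s : ℝ, 0 < s ∧ (∀ x ∈ T, x ≠ 0 → ∃ c ∈ T, ‖c‖ ^ p = ‖x‖) ∧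
        (∀ u ∈ T, ‖u‖ ≤ 1 → ∃ w ∈ T, ‖u - w ^ p‖ ≤ ‖(p : NormedAlgClosure F)‖ ^ s)) :
    scholze2012_frobeniusSurjective_finite_over_Kinf :=
  fun hp T hfin _ hu hu1 => frobeniusSurjective_of_tame_local hp (hC hp) T hfin hu hu1

end TateAlmostEtale

/-! ### §4 The discharge -/

/-- **Finite extensions of `ℚ_p(μ_{p^∞})` inside `F̄` have surjective Frobenius on `T°/p`** —
`scholze2012_frobeniusSurjective_finite_over_Kinf` (Scholze 2012 Thm. 3.7 (i) for the perfectoid base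
`ℚ_p(μ_{p^∞})^`, read on the dense subfields `T`; Kedlaya–Liu Thm. 4.5.6) is a THEOREM: for every
non-archimedean local field `F` of characteristic `0`, every prime `p` below it, every intermediate field
`K_∞ ⊆ T ⊆ F̄` finite over `K_∞` and every `u ∈ T` with `‖u‖ ≤ 1` there is `w ∈ T` with `‖u − w^p‖ ≤ ‖p‖`.
Proof: `TateAlmostEtale.frobeniusSurjective_of_tame` (Sylow dévissage + descent + bootstrap) applied to
the tame package `TateAlmostEtale.tamePackage`. [cite: Scholze2012, Def. 3.1, Lemma 3.2 and Thm. 3.7 (i)]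
[cite: KedlayaLiu2015, arXiv Def. 4.5.1, Ex. 4.3.8, Thm. 4.5.6] [cite: Tate1967, §3.2 Prop. 9] -/
theorem scholze2012_frobeniusSurjective_finite_over_Kinf_holds :
    scholze2012_frobeniusSurjective_finite_over_Kinf :=
  TateAlmostEtale.frobeniusSurjective_of_tame fun hp T hfin hd => TateAlmostEtale.tamePackage hp T hfin hd

end Literature.NumberTheory.PAdicHodge

end
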